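import Literature.NumberTheory.GaloisRepresentations.HeckeCharacterOfGrossencharakterRigidity
import Literature.NumberTheory.GaloisRepresentations.AlgebraicHeckeCharacterGrossencharakterProofs
import Literature.NumberTheory.GaloisRepresentations.CMTypeHeckeCharacter
import Literature.NumberTheory.GaloisRepresentations.HeckeCharacterOfRayClassModulus
import Literature.NumberTheory.Automorphic.GaloisActionPlaces
import HarnessLib

/-!
# Sharpening the modulus of a Größencharakter: the SUPPORT of the modulus can be taken to be exactly the ramification

Topic `Literature/NumberTheory/GaloisRepresentations`, namespace `Literature.NumberTheory.GaloisRepresentations`.  THEOREMS ONLY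
(no definition, no instance, no named fact, no `sorry`).  Companion of `HeckeCharacterOfGrossencharakter` (Neukirch VII (6.14): the
Hecke character `ω = heckeOfGross h𝔣 hψ` of an ideal Größencharakter datum `ψ mod 𝔣` of type `(p, q)`),
`AlgebraicHeckeCharacterGrossencharakterProofs` (`HeckeCharacter.HasInfinityType.idealPow_span_eq`: the ideal character `v ↦ ω(ϖ_v)` of an
algebraic Hecke character IS a Größencharakter modulo any module of definition; `HeckeCharacter.exists_isModulus_of_ramified`: a module of
definition supported EXACTLY on the ramified places) and `HeckeCharacterOfGrossencharakterRigidity` (multiplicity one for `GL(1)`).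

A datum `IsGrossencharakter 𝔣 p q ψ` only constrains `ψ` OFF `𝔣`: the modulus `𝔣` may be IMPRIMITIVE (divisible by primes at which the
character is unramified), and the values `ψ 𝔭` at `𝔭 ∣ 𝔣` are junk.  This file records the standard remedy (Neukirch VII §6, discussion
after (6.11): «the smallest module of definition is the conductor»; here only the SUPPORT is sharpened, exponents are not claimed minimal):

* `HeckeCharacter.isGrossencharakter_valueAtUniformizer_of_isModulus` — for an algebraic Hecke character `χ` of type `(p, q)` with module of
  definition `(T, e)`, the ideal datum `v ↦ χ(ϖ_v)` is a Größencharakter modulo `modulusIdeal T e` (repackaging of `idealPow_span_eq`);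
* ★ `IsGrossencharakter.exists_sharp` — every datum `ψ mod 𝔣` of type `(p, q)` has a SHARP companion `ψ′ mod 𝔣′`: `𝔣′ ≠ 0`,
  `supp 𝔣′ ⊆ supp 𝔣`, `IsGrossencharakter 𝔣′ p q ψ′`, `ψ′ = ψ` off `𝔣`, and **`supp 𝔣′ = ram χ` for EVERY Hecke character `χ` realising `ψ′`**
  (i.e. with `χ(ϖ_v) = ψ′ v` for all but finitely many `v`) — in particular for `heckeOfGross` of either datum;
* `IsGrossencharakter.exists_sharp_inv` — the same sharpness read on realisations of the INVERSE values `(ψ′ v)⁻¹` (the form in which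
  Weil's `ℓ`-adic character of `ψ⁻¹` is pinned in the tree, `EllipticCurves/…RttCharRoadPinnedCharacter`).

Proof of ★: `ω := heckeOfGross h𝔣 hψ`, `T := ram ω` (finite, `finite_ramifiedPlaces_holds`), `(T, e)` a module of definition
(`exists_isModulus_of_ramified`), `𝔣′ := modulusIdeal T e = ∏_{v ∈ T} 𝔭_v^{e_v+1}`, `ψ′ v := ω(ϖ_v)`; `ω` is unramified off `𝔣` with
`ω(ϖ_v) = ψ v` there (`heckeOfGross_isUnramifiedAt`, `heckeOfGross_valueAtUniformizer`), so `T ⊆ supp 𝔣` and `ψ′ = ψ` off `𝔣`; a Hecke character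
agreeing with `ψ′` at almost all uniformisers IS `ω` (`HeckeCharacter.ext_of_eventually_valueAtUniformizer_eq`), whence its ramification is `T`.

Filed for the «ROAD-𝔪» repair of crux L `SmallImageLowerHalfBothSigns` (stmt-BirchSwinnertonDyer-23599) of `Summits/BirchSwinnertonDyer`
(the producer of the theta partner's Größencharakter must export a modulus whose primes are all ramified); nothing about BSD is proved here.

## References
* J. Neukirch, *Algebraic Number Theory* (1999), Ch. VII §6, (6.11)–(6.14) (modules of definition, conductor, Größencharaktere mod 𝔪).
  [NeukirchANT1999]
* J. W. S. Cassels, A. Fröhlich (eds.), *Algebraic Number Theory* (1967), Ch. VII (Tate) §4 Prop. 4.1. [CasselsFrohlichANT1967]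

## Mathlib / tree search
Tree: `heckeOfGross`, `heckeOfGross_isUnramifiedAt`, `heckeOfGross_valueAtUniformizer`, `heckeOfGross_hasInfinityType`
(`HeckeCharacterOfGrossencharakter`); `HeckeCharacter.exists_isModulus_of_ramified`, `HeckeCharacter.HasInfinityType.idealPow_span_eq`
(`AlgebraicHeckeCharacterGrossencharakterProofs`); `HeckeCharacter.modulusIdeal`, `modulusIdeal_le_iff`, `modulusIdeal_ne_bot` (`HeckeCharacterDictionary`);
`HeckeCharacter.ext_of_eventually_valueAtUniformizer_eq` (`HeckeCharacterWeakApproximation`); `IsUnramifiedAt.inv'`, `valueAtUniformizer_inv'`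
(`CMTypeHeckeCharacter`).  `lean search 'exists_sharp|sharp_modulus|isGrossencharakter_valueAtUniformizer'` found nothing.  Mathlib:
`Ideal.finite_factors`, `Filter.eventually_cofinite`, `Set.Finite.mem_toFinset`, `Prime.exists_mem_finset_dvd`, `Ideal.absNorm_dvd_absNorm_of_le`.
-/

noncomputable section

open NumberField IsDedekindDomain IsDedekindDomain.HeightOneSpectrum Filter
open scoped ComplexConjugate Pointwise

namespace Literature.NumberTheory.GaloisRepresentations

variable {K : Type} [Field K] [NumberField K]

/-! ### §1 The ideal datum of an algebraic Hecke character is a Größencharakter modulo any module of definition -/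

/-- **The ideal character `v ↦ χ(ϖ_v)` of an algebraic Hecke character of type `(p, q)` is a Größencharakter modulo `𝔪(T, e)`** for every
module of definition `(T, e)` of `χ` (Neukirch VII (6.13)–(6.14), «Hecke character ↦ Größencharakter mod 𝔪»; the tree's
`HasInfinityType.idealPow_span_eq` repackaged as the predicate `IsGrossencharakter`; the values `χ(ϖ_v) ∈ ℂˣ` are never zero).
[cite: NeukirchANT1999, Ch. VII §6 Prop. (6.13) and Cor. (6.14)] -/
theorem HeckeCharacter.isGrossencharakter_valueAtUniformizer_of_isModulus {χ : HeckeCharacter K} {p q : InfinitePlace K → ℤ}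
    (hinf : χ.HasInfinityType p q) {T : Finset (HeightOneSpectrum (𝓞 K))} {e : HeightOneSpectrum (𝓞 K) → ℕ}
    (hmod : χ.IsModulus T e) :
    IsGrossencharakter (HeckeCharacter.modulusIdeal T e) p q (fun v => χ.valueAtUniformizer v) := by
  refine ⟨fun v _ => ?_, fun b c hb hc hcop hbc hpos => hinf.idealPow_span_eq hmod hb hc hcop hbc hpos⟩
  simp only [HeckeCharacter.valueAtUniformizer]
  exact Units.ne_zero _

/-- A rational prime dividing `N(𝔪(T, e)) = ∏_{v ∈ T} N𝔭_v^{e_v+1}` divides `N𝔭_v` for some `v ∈ T`. [folklore] -/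
private theorem HeckeCharacter.exists_mem_of_prime_dvd_absNorm_modulusIdeal {T : Finset (HeightOneSpectrum (𝓞 K))}
    {e : HeightOneSpectrum (𝓞 K) → ℕ} {ℓ : ℕ} (hℓ : ℓ.Prime) (h : ℓ ∣ Ideal.absNorm (HeckeCharacter.modulusIdeal T e)) :
    ∃ v ∈ T, ℓ ∣ Ideal.absNorm v.asIdeal := by
  classical
  rw [HeckeCharacter.modulusIdeal, map_prod] at h
  obtain ⟨v, hv, hdvd⟩ := (Nat.Prime.prime hℓ).exists_mem_finset_dvd h
  rw [map_pow] at hdvd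
  exact ⟨v, hv, (Nat.Prime.prime hℓ).dvd_of_dvd_pow hdvd⟩

/-! ### §2 Sharpening the modulus of a Größencharakter datum -/

section Sharp

variable {𝔣 : Ideal (𝓞 K)} {p q : InfinitePlace K → ℤ} {ψ : HeightOneSpectrum (𝓞 K) → ℂ}

/-- Off the (finitely many) primes of a non-zero ideal `𝔣`, eventually: `∀ᶠ v, ¬ 𝔣 ≤ 𝔭_v`. [folklore] -/
private theorem eventually_not_le_asIdeal (h𝔣 : 𝔣 ≠ ⊥) : ∀ᶠ v : HeightOneSpectrum (𝓞 K) in cofinite, ¬ 𝔣 ≤ v.asIdeal :=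
  eventually_cofinite.mpr ((Ideal.finite_factors h𝔣).subset fun v hv => by
    by_contra hle; exact hv fun hle' => hle (Ideal.dvd_iff_le.mpr hle'))

/-- **The ramification of a realisation.**  If a Hecke character `χ` agrees with the ideal datum of `ω = heckeOfGross h𝔣 hψ` at almost every
uniformiser, then `χ = ω`; in particular `χ` is unramified off `𝔣`. (Multiplicity one for `GL(1)`, Cassels–Fröhlich VII Prop. 4.1.)
[cite: CasselsFrohlichANT1967, Ch. VII §4 Prop. 4.1 (proof)] [cite: NeukirchANT1999, Ch. VII §6 Cor. (6.14)] -/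
theorem eq_heckeOfGross_of_eventually_valueAtUniformizer_eq (h𝔣 : 𝔣 ≠ ⊥) (hψ : IsGrossencharakter 𝔣 p q ψ)
    {χ : HeckeCharacter K} (hχ : ∀ᶠ v in cofinite, χ.valueAtUniformizer v = ψ v) : χ = heckeOfGross h𝔣 hψ := by
  refine HeckeCharacter.ext_of_eventually_valueAtUniformizer_eq ?_
  filter_upwards [hχ, eventually_not_le_asIdeal h𝔣] with v hv hv𝔣
  rw [hv, heckeOfGross_valueAtUniformizer h𝔣 hψ hv𝔣]

/-- ★ **Sharpening the modulus of a Größencharakter datum (support form).**  For a datum `ψ mod 𝔣` of infinity type `(p, q)` (`𝔣 ≠ 0`)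
there are an ideal `𝔣′ ≠ 0` and values `ψ′` with: every prime of `𝔣′` is a prime of `𝔣`; `IsGrossencharakter 𝔣′ p q ψ′`; `ψ′ = ψ` off `𝔣`;
and **for every Hecke character `χ` with `χ(ϖ_v) = ψ′ v` for all but finitely many `v`, the primes of `𝔣′` are EXACTLY the places where
`χ` is ramified.**  Construction: `ω = heckeOfGross h𝔣 hψ`, `𝔣′ = ∏_{v ∈ ram ω} 𝔭_v^{e_v+1}` for a module of definition `(ram ω, e)`
(Neukirch VII §6, after (6.11)), `ψ′ v = ω(ϖ_v)`. [cite: NeukirchANT1999, Ch. VII §6 (6.11)–(6.14)] [cite: CasselsFrohlichANT1967, Ch. VII §4 Prop. 4.1] -/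
theorem IsGrossencharakter.exists_sharp (h𝔣 : 𝔣 ≠ ⊥) (hψ : IsGrossencharakter 𝔣 p q ψ) :
    ∃ (𝔣' : Ideal (𝓞 K)) (ψ' : HeightOneSpectrum (𝓞 K) → ℂ),
      𝔣' ≠ ⊥ ∧ (∀ w : HeightOneSpectrum (𝓞 K), 𝔣' ≤ w.asIdeal → 𝔣 ≤ w.asIdeal) ∧
      (∀ ℓ : ℕ, ℓ.Prime → ℓ ∣ Ideal.absNorm 𝔣' → ℓ ∣ Ideal.absNorm 𝔣) ∧
      IsGrossencharakter 𝔣' p q ψ' ∧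
      (∀ v : HeightOneSpectrum (𝓞 K), ¬ 𝔣 ≤ v.asIdeal → ψ' v = ψ v) ∧
      (∀ χ : HeckeCharacter K, (∀ᶠ v in cofinite, χ.valueAtUniformizer v = ψ' v) →
        ∀ w : HeightOneSpectrum (𝓞 K), 𝔣' ≤ w.asIdeal ↔ ¬ χ.IsUnramifiedAt w) := by
  classical
  set ω : HeckeCharacter K := heckeOfGross h𝔣 hψ with hωdef
  obtain ⟨e, hmod⟩ := ω.exists_isModulus_of_ramified
  set T : Finset (HeightOneSpectrum (𝓞 K)) := (HeckeCharacter.finite_ramifiedPlaces_holds ω).toFinset with hTdef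
  have hT : ∀ w : HeightOneSpectrum (𝓞 K), w ∈ T ↔ ¬ ω.IsUnramifiedAt w := fun w => by
    rw [hTdef, Set.Finite.mem_toFinset]; rfl
  have hψ' : IsGrossencharakter (HeckeCharacter.modulusIdeal T e) p q (fun v => ω.valueAtUniformizer v) :=
    HeckeCharacter.isGrossencharakter_valueAtUniformizer_of_isModulus (heckeOfGross_hasInfinityType h𝔣 hψ) hmod
  -- a ramified place of `ω` is a prime of `𝔣`
  have hTsupp : ∀ w ∈ T, 𝔣 ≤ w.asIdeal := fun w hw => by
    rw [hT] at hw
    by_contra h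
    exact hw (heckeOfGross_isUnramifiedAt h𝔣 hψ h)
  refine ⟨HeckeCharacter.modulusIdeal T e, fun v => ω.valueAtUniformizer v, HeckeCharacter.modulusIdeal_ne_bot T e,
    fun w hw => hTsupp w (HeckeCharacter.modulusIdeal_le_iff.mp hw), fun ℓ hℓ hℓN => ?_, hψ',
    fun v hv => heckeOfGross_valueAtUniformizer h𝔣 hψ hv, fun χ hχ w => ?_⟩
  · -- a rational prime of `N𝔣′` lies under some `w ∈ T ⊆ supp 𝔣`
    obtain ⟨w, hw, hℓw⟩ := HeckeCharacter.exists_mem_of_prime_dvd_absNorm_modulusIdeal hℓ hℓN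
    exact hℓw.trans (Ideal.absNorm_dvd_absNorm_of_le (hTsupp w hw))
  · -- a realisation of `ψ′` is `ω` itself
    have hχω : χ = ω := by
      refine HeckeCharacter.ext_of_eventually_valueAtUniformizer_eq ?_
      filter_upwards [hχ] with v hv
      rw [hv]
    rw [HeckeCharacter.modulusIdeal_le_iff, hT, hχω]

/-- **Sharpening, read on realisations of the inverse values.**  Same `𝔣′`, `ψ′` as in `exists_sharp`, with the sharpness clause stated for
Hecke characters `χ` with `χ(ϖ_v) = (ψ′ v)⁻¹` almost everywhere (then `χ⁻¹` realises `ψ′`, and `ram χ⁻¹ = ram χ`): this is the currency of the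
tree's pinned `ℓ`-adic characters (Weil's character of the idelic lift of `ψ⁻¹`). [cite: NeukirchANT1999, Ch. VII §6 (6.11)–(6.14)] -/
theorem IsGrossencharakter.exists_sharp_inv (h𝔣 : 𝔣 ≠ ⊥) (hψ : IsGrossencharakter 𝔣 p q ψ) :
    ∃ (𝔣' : Ideal (𝓞 K)) (ψ' : HeightOneSpectrum (𝓞 K) → ℂ),
      𝔣' ≠ ⊥ ∧ (∀ w : HeightOneSpectrum (𝓞 K), 𝔣' ≤ w.asIdeal → 𝔣 ≤ w.asIdeal) ∧
      (∀ ℓ : ℕ, ℓ.Prime → ℓ ∣ Ideal.absNorm 𝔣' → ℓ ∣ Ideal.absNorm 𝔣) ∧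
      IsGrossencharakter 𝔣' p q ψ' ∧
      (∀ v : HeightOneSpectrum (𝓞 K), ¬ 𝔣 ≤ v.asIdeal → ψ' v = ψ v) ∧
      (∀ χ : HeckeCharacter K, (∀ᶠ v in cofinite, χ.valueAtUniformizer v = ψ' v) →
        ∀ w : HeightOneSpectrum (𝓞 K), 𝔣' ≤ w.asIdeal ↔ ¬ χ.IsUnramifiedAt w) ∧
      (∀ χ : HeckeCharacter K, (∀ᶠ v in cofinite, χ.valueAtUniformizer v = (ψ' v)⁻¹) →
        ∀ w : HeightOneSpectrum (𝓞 K), 𝔣' ≤ w.asIdeal ↔ ¬ χ.IsUnramifiedAt w) := by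
  obtain ⟨𝔣', ψ', h𝔣', hsupp, hnorm, hψ', heq, hsharp⟩ := hψ.exists_sharp h𝔣
  refine ⟨𝔣', ψ', h𝔣', hsupp, hnorm, hψ', heq, hsharp, fun χ hχ w => ?_⟩
  have hinv : ∀ᶠ v in cofinite, χ⁻¹.valueAtUniformizer v = ψ' v := by
    filter_upwards [hχ] with v hv
    rw [HeckeCharacter.valueAtUniformizer_inv', hv, inv_inv]
  rw [hsharp χ⁻¹ hinv w, not_iff_not]
  exact ⟨fun h => by simpa using h.inv', fun h => h.inv'⟩

/-- **Sharpness, forward ⇒ two-sided.**  If every Hecke character realising the datum `ψ mod 𝔣` is ramified at the primes of `𝔣`, then for every such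
realisation the primes of `𝔣` are EXACTLY its ramified places: a realisation IS `heckeOfGross h𝔣 hψ` (multiplicity one for `GL(1)`), which is
unramified off `𝔣` (Neukirch VII (6.14)). [cite: NeukirchANT1999, Ch. VII §6 Cor. (6.14)] [cite: CasselsFrohlichANT1967, Ch. VII §4 Prop. 4.1] -/
theorem IsGrossencharakter.sharp_iff_of_sharp (h𝔣 : 𝔣 ≠ ⊥) (hψ : IsGrossencharakter 𝔣 p q ψ)
    (h : ∀ χ : HeckeCharacter K, (∀ᶠ v in cofinite, χ.valueAtUniformizer v = ψ v) →
      ∀ w : HeightOneSpectrum (𝓞 K), 𝔣 ≤ w.asIdeal → ¬ χ.IsUnramifiedAt w) :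
    ∀ χ : HeckeCharacter K, (∀ᶠ v in cofinite, χ.valueAtUniformizer v = ψ v) →
      ∀ w : HeightOneSpectrum (𝓞 K), 𝔣 ≤ w.asIdeal ↔ ¬ χ.IsUnramifiedAt w := by
  intro χ hχ w
  refine ⟨h χ hχ w, fun hn => ?_⟩
  by_contra hle
  rw [eq_heckeOfGross_of_eventually_valueAtUniformizer_eq h𝔣 hψ hχ] at hn
  exact hn (heckeOfGross_isUnramifiedAt h𝔣 hψ hle)

/-! ### §3 Sharpening with UNIFORM exponents: a support-stable sharp modulus is stable -/

/-- ★ **Sharpening with a uniform exponent.**  Same as `exists_sharp`, but the sharp modulus is `𝔣′ = ∏_{v ∈ ram ω} 𝔭_v^{N+1}` with ONE exponent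
`N` (raising the exponents of a module of definition keeps it one, Neukirch VII §6 (6.11)); consequently, for every automorphism `c` of `K`
under which the SUPPORT of `𝔣′` is stable (`𝔣′ ≤ 𝔭_{c • w} ↔ 𝔣′ ≤ 𝔭_w`), the IDEAL `𝔣′` is stable: `c • 𝔣′ = 𝔣′`.
[cite: NeukirchANT1999, Ch. VII §6 (6.11)–(6.14)] [cite: CasselsFrohlichANT1967, Ch. VII §4 Prop. 4.1] -/
theorem IsGrossencharakter.exists_sharp_uniform (h𝔣 : 𝔣 ≠ ⊥) (hψ : IsGrossencharakter 𝔣 p q ψ) :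
    ∃ (𝔣' : Ideal (𝓞 K)) (ψ' : HeightOneSpectrum (𝓞 K) → ℂ),
      𝔣' ≠ ⊥ ∧ (∀ w : HeightOneSpectrum (𝓞 K), 𝔣' ≤ w.asIdeal → 𝔣 ≤ w.asIdeal) ∧
      (∀ ℓ : ℕ, ℓ.Prime → ℓ ∣ Ideal.absNorm 𝔣' → ℓ ∣ Ideal.absNorm 𝔣) ∧
      IsGrossencharakter 𝔣' p q ψ' ∧
      (∀ v : HeightOneSpectrum (𝓞 K), ¬ 𝔣 ≤ v.asIdeal → ψ' v = ψ v) ∧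
      (∀ χ : HeckeCharacter K, (∀ᶠ v in cofinite, χ.valueAtUniformizer v = ψ' v) →
        ∀ w : HeightOneSpectrum (𝓞 K), 𝔣' ≤ w.asIdeal ↔ ¬ χ.IsUnramifiedAt w) ∧
      (∀ c : K ≃ₐ[ℚ] K, (∀ w : HeightOneSpectrum (𝓞 K), 𝔣' ≤ (c • w).asIdeal ↔ 𝔣' ≤ w.asIdeal) → c • 𝔣' = 𝔣') := by
  classical
  set ω : HeckeCharacter K := heckeOfGross h𝔣 hψ with hωdef
  obtain ⟨e, hmod⟩ := ω.exists_isModulus_of_ramified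
  set T : Finset (HeightOneSpectrum (𝓞 K)) := (HeckeCharacter.finite_ramifiedPlaces_holds ω).toFinset with hTdef
  have hT : ∀ w : HeightOneSpectrum (𝓞 K), w ∈ T ↔ ¬ ω.IsUnramifiedAt w := fun w => by
    rw [hTdef, Set.Finite.mem_toFinset]; rfl
  -- one uniform exponent `N = max e`
  set N : ℕ := T.sup e with hNdef
  have hmodN : ω.IsModulus T (fun _ => N) := hmod.mono fun v hv => Finset.le_sup (f := e) hv
  have hψ' : IsGrossencharakter (HeckeCharacter.modulusIdeal T (fun _ => N)) p q (fun v => ω.valueAtUniformizer v) :=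
    HeckeCharacter.isGrossencharakter_valueAtUniformizer_of_isModulus (heckeOfGross_hasInfinityType h𝔣 hψ) hmodN
  have hTsupp : ∀ w ∈ T, 𝔣 ≤ w.asIdeal := fun w hw => by
    rw [hT] at hw
    by_contra h
    exact hw (heckeOfGross_isUnramifiedAt h𝔣 hψ h)
  refine ⟨HeckeCharacter.modulusIdeal T (fun _ => N), fun v => ω.valueAtUniformizer v, HeckeCharacter.modulusIdeal_ne_bot T _,
    fun w hw => hTsupp w (HeckeCharacter.modulusIdeal_le_iff.mp hw), fun ℓ hℓ hℓN => ?_, hψ',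
    fun v hv => heckeOfGross_valueAtUniformizer h𝔣 hψ hv, fun χ hχ w => ?_, fun c hc => ?_⟩
  · obtain ⟨w, hw, hℓw⟩ := HeckeCharacter.exists_mem_of_prime_dvd_absNorm_modulusIdeal hℓ hℓN
    exact hℓw.trans (Ideal.absNorm_dvd_absNorm_of_le (hTsupp w hw))
  · have hχω : χ = ω := by
      refine HeckeCharacter.ext_of_eventually_valueAtUniformizer_eq ?_
      filter_upwards [hχ] with v hv
      rw [hv]
    rw [HeckeCharacter.modulusIdeal_le_iff, hT, hχω]
  · -- support-stable ⇒ ideal-stable (uniform exponent): `c • T = T`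
    have hcT : ∀ w : HeightOneSpectrum (𝓞 K), c • w ∈ T ↔ w ∈ T := fun w => by
      rw [← HeckeCharacter.modulusIdeal_le_iff (e := fun _ => N), ← HeckeCharacter.modulusIdeal_le_iff (e := fun _ => N)]
      exact hc w
    have himage : T.image (fun w : HeightOneSpectrum (𝓞 K) => c • w) = T := by
      ext u
      simp only [Finset.mem_image]
      constructor
      · rintro ⟨w, hw, rfl⟩
        exact (hcT w).mpr hw
      · intro hu
        exact ⟨c⁻¹ • u, (hcT _).mp (by rwa [smul_inv_smul]), smul_inv_smul c u⟩
    have hmap := map_prod (MulDistribMulAction.toMonoidHom (Ideal (𝓞 K)) c) (fun v : HeightOneSpectrum (𝓞 K) => v.asIdeal ^ (N + 1)) T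
    simp only [MulDistribMulAction.toMonoidHom_apply] at hmap
    rw [HeckeCharacter.modulusIdeal, hmap]
    conv_rhs => rw [← himage]
    rw [Finset.prod_image fun x _ y _ h => MulAction.injective c h]
    refine Finset.prod_congr rfl fun w _ => ?_
    rw [smul_pow', ← Literature.NumberTheory.Automorphic.HeightOneSpectrum.smul_asIdeal]

end Sharp

end Literature.NumberTheory.GaloisRepresentations

end
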